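import Literature.MathematicalPhysics.QuantumFieldTheory.Balaban1983to89.B9Thm34TowerVacuumLadderRows

/-!
# `Balaban1983to89.B9Eq349TowerCoarseRowsOfMajorant` — T. Bałaban, *Propagators for lattice gauge theories in a background field*, Commun. Math. Phys. **99** (1985) 389–434
# [Balaban1985BackgroundPropagators] Thm 3.2 (3.48) p. 398 ∕ (3.49) p. 399, Thm 3.1 (3.42)∕(3.47) pp. 397–398, with [Balaban1984PropagatorsII] (2.49), (2.51) p. 232, Lemma 2.1 (2.61) p. 234: **THE
# READ-BACK OF BLOCK MAJORANTS ON THE COARSE (UNIT) LATTICE INTO THE NE9 CHAIN's CURRENCY** — an endomorphism `T` (or a difference `T₁ − T₂`) of the coarse carrier `SiteL2K ℂ d m c₁ W`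
# whose `𝔸`-read, realified block majorant over `towerGeom` (blocks = sites) is `K·e^{−δ d₁}` has (i) the `W`-valued SITE ROW `‖(Tg)(x)‖_W ≤ M_φ′M_φ(Σ‖b_i‖)M₂·K·e^{−δ·d₁(x, v)}·F` for `g`
# supported at `v`, and (ii) the LATTICE-FREE `ℓ^∞ → ℓ^∞` letter `‖(Tg)(x)‖_W ≤ M_φ′M_φ(Σ‖b_i‖)M₂·K·c₁(d, δ, 1)·sup‖g‖` — the consumers' shape for this lineage's coarse ladders
# (`B9Eq367TowerQGGQInvLadderClosed`: `c_k(U) − c_k(1)`; `B9Eq365TowerQGGQWordLadder`: `X_k(U) − X_k(1)`), exactly as `B9Thm34TowerVacuumLadderRows` did for `G′_k` on the fine carrier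

statement-level skeleton of published theorems with citation tags; proofs where landed; nothing here is a claim about the Yang–Mills mass gap

CITATION HEADER (lean-in-tree rule).  Audit cell `pub-balaban`, sub-cell `t4`, BINDER row NE9; NE9 crux-team LEAF PROVER 01 (`b2b-balaban-t4-ne9-formalise-leaf-01`,
gen 99; bears_on: R4/N22).  Vocabulary BY NAME: this lineage's `B9Eq342MajorantReadingSeam.blockRowW_of_hasMajorant_conj_readA`, `B9Thm34TowerVacuumLadderRows.supRowW_of_hasMajorant_conj_readA`,
`B9Eq341TowerBlockGeometry.towerGeom` ∕ `h261_towerGeom`, `B9Eq324PenaltyKernelForm.readA` ∕ `readA_sub`, r06's `B9Eq352DivFormLetters.conj` ∕ `conj_sub`, pv08's `B6RandomWalk.HasMajorant` ∕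
`Ineq261` ∕ `c1_nonneg`.  Sources read through those files' verbatim quotations: [Balaban1985BackgroundPropagators] pp. 397–399; [Balaban1984PropagatorsII] pp. 232, 234.  [folklore]
COMPOSITION BY NAME; NOTHING of print's proofs is reproduced.

WHAT IS PROVED (sorry-free; proof lane — no `def`).
* **`siteRowW_of_hasMajorant_exp`**, **`supRowW_of_hasMajorant_exp`** — (i) and (ii) for one endomorphism; **`siteRowW_sub_of_hasMajorant_exp`**, **`supRowW_sub_of_hasMajorant_exp`** — the same
  for a difference `T₁ − T₂` given the majorant of `conj b (readA φ T₁) − conj b (readA φ T₂)`.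
HONEST SCOPE.  Bookkeeping; the majorant is a hypothesis; NE9 NOT PRINTED ∕ NOT PROVED; spine PROVED 0∕9; rung (B)+1 finite T⁴ — NOT infinite volume, NOT mass gap, NOT BetaPertH, NOT
Clay.  HONEST DEPENDENCY: continuum YM on T⁴ ⇐ BetaPertH ∧ nine spine estimates (0/9 proved); BetaPertH ⇐ (D1) ∧ (D4) ∧ CAP+tail; G-an2-4 gates asym, D1 and NE2/3/4.  NEW file;
nothing modified.  Net new unproved facts: 0.
-/

noncomputable section

open scoped BigOperators

namespace Literature.MathematicalPhysics.QuantumFieldTheory.Balaban1983to89.B9Eq349TowerCoarseRowsOfMajorant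

open B4Sect5Torus (TSite)
open B9Eq311L2Pairing (WL2)
open B11Eq103H1Complex (SiteL2K)
open B6RandomWalk (HasMajorant Ineq261 c1_nonneg)
open B9Thm34Ext (toB6)
open B9Eq352DivFormLetters (conj conj_sub)
open B9Eq324PenaltyKernelForm (readA readA_sub)
open B9Eq341TowerBlockGeometry (towerGeom h261_towerGeom)
open B9Thm37GlueTorus (tdist1)
open B9Eq342MajorantReadingSeam (blockRowW_of_hasMajorant_conj_readA)
open B9Thm34TowerVacuumLadderRows (supRowW_of_hasMajorant_conj_readA)

variable {d : ℕ} (L : ℕ) (m : Fin d → ℕ) [∀ i, NeZero (m i)] (n : ℕ) (η M Rr : ℝ) (H : Prop)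
  {𝔸 : Type*} [NormedRing 𝔸] [NormedAlgebra ℂ 𝔸] {W : Type*} [NormedAddCommGroup W] [InnerProductSpace ℂ W]
  (φ : W ≃ₗ[ℂ] 𝔸) {c₁ : ℝ} {Mφ Mφ' : ℝ} (hMφ : 0 ≤ Mφ) (hMφ' : 0 ≤ Mφ') (hφn : ∀ w, ‖φ w‖ ≤ Mφ * ‖w‖) (hφn' : ∀ X, ‖φ.symm X‖ ≤ Mφ' * ‖X‖)
  {ι : Type} [Fintype ι] (b : Module.Basis ι ℝ 𝔸) {M₂ : ℝ} (hM₂ : 0 ≤ M₂) (hrepr : ∀ (v : 𝔸) (i : ι), |b.repr v i| ≤ M₂ * ‖v‖)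
include hMφ hMφ' hφn hφn' hM₂ hrepr

/-- **(i) MAJORANT ⟹ SITE ROW WITH DECAY** on the coarse carrier (blocks = sites): `conj b (readA φ T) ≺ K·e^{−δ d₁}` gives `‖(Tg)(x)‖_W ≤ M_φ′M_φ((Σ‖b_i‖)M₂·K·e^{−δ d₁(x,v)})·F` for `g`
vanishing off the site `v` with `‖g(v)‖ ≤ F`. [cite: Balaban1985BackgroundPropagators, Thm 3.2 (3.48) p.398, Thm 3.1 (3.42) p.397; Balaban1984PropagatorsII, (2.51) p.232] -/
theorem siteRowW_of_hasMajorant_exp (T : SiteL2K ℂ d m c₁ W →ₗ[ℂ] SiteL2K ℂ d m c₁ W) {K δ : ℝ}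
    (hT : HasMajorant (g := toB6 (towerGeom L m n η M) Rr H) (fun q : TSite d m × ι => q.1) (conj b (readA φ T))
      (fun a a' => K * Real.exp (-(δ * (towerGeom L m n η M).dist a a'))))
    (v : TSite d m) (g : SiteL2K ℂ d m c₁ W) (F : ℝ) (hF : 0 ≤ F) (hoff : ∀ x, x ≠ v → WL2.equiv ℂ (fun _ : TSite d m => c₁) W g x = 0)
    (hbd : ∀ x, x = v → ‖WL2.equiv ℂ (fun _ : TSite d m => c₁) W g x‖ ≤ F) (x : TSite d m) :
    ‖WL2.equiv ℂ (fun _ : TSite d m => c₁) W (T g) x‖ ≤ Mφ' * Mφ * ((∑ i, ‖b i‖) * M₂ * (K * Real.exp (-(δ * tdist1 m x v)))) * F :=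
  blockRowW_of_hasMajorant_conj_readA φ hMφ hMφ' hφn hφn' b hM₂ hrepr (G := toB6 (towerGeom L m n η M) Rr H) (fun y : TSite d m => y) T _ hT v g F hF hoff hbd x

/-- **(ii) MAJORANT ⟹ LATTICE-FREE `ℓ^∞ → ℓ^∞` LETTER** on the coarse carrier: `conj b (readA φ T) ≺ K·e^{−δ d₁}` (`K ≥ 0`, `δ > 0`) gives, for EVERY `g` with `‖g(y)‖_W ≤ F`,
`‖(Tg)(x)‖_W ≤ M_φ′M_φ((Σ‖b_i‖)M₂·K·c₁(d, δ, 1))·F` by the row sum (2.61) of `towerGeom` (every period).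
[cite: Balaban1985BackgroundPropagators, (3.47) p.398, (3.49) p.399; Balaban1984PropagatorsII, (2.49) p.232, Lemma 2.1 (2.61) p.234] -/
theorem supRowW_of_hasMajorant_exp (T : SiteL2K ℂ d m c₁ W →ₗ[ℂ] SiteL2K ℂ d m c₁ W) {K δ : ℝ} (hK : 0 ≤ K) (hδ : 0 < δ)
    (hT : HasMajorant (g := toB6 (towerGeom L m n η M) Rr H) (fun q : TSite d m × ι => q.1) (conj b (readA φ T))
      (fun a a' => K * Real.exp (-(δ * (towerGeom L m n η M).dist a a'))))
    (g : SiteL2K ℂ d m c₁ W) (F : ℝ) (hF : 0 ≤ F) (hbd : ∀ x, ‖WL2.equiv ℂ (fun _ : TSite d m => c₁) W g x‖ ≤ F) (x : TSite d m) :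
    ‖WL2.equiv ℂ (fun _ : TSite d m => c₁) W (T g) x‖ ≤ Mφ' * Mφ * ((∑ i, ‖b i‖) * M₂ * (K * B6.c1 d δ 1)) * F := by
  have h261 : Ineq261 d (toB6 (towerGeom L m n η M) Rr H) δ 1 := h261_towerGeom L m n η M Rr H one_pos hδ
  have hrow : ∀ a : (toB6 (towerGeom L m n η M) Rr H).Site,
      ∑ a', K * Real.exp (-(δ * (towerGeom L m n η M).dist a a')) ≤ K * B6.c1 d δ 1 := fun a => by
    rw [← Finset.mul_sum]
    refine mul_le_mul_of_nonneg_left ?_ hK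
    have h1 := h261 a
    rw [one_mul] at h1
    exact h1
  exact supRowW_of_hasMajorant_conj_readA φ hMφ hMφ' hφn hφn' b hM₂ hrepr (G := toB6 (towerGeom L m n η M) Rr H) (fun y : TSite d m => y) T _ hT hrow g F hF hbd x

/-- **(i′) FOR A DIFFERENCE**: `conj b (readA φ T₁) − conj b (readA φ T₂) ≺ K·e^{−δ d₁}` gives the site row of `T₁ − T₂` with decay.
[cite: Balaban1985BackgroundPropagators, Thm 3.2 (3.48) p.398, (3.67) p.403; Balaban1984PropagatorsII, (2.51) p.232] -/
theorem siteRowW_sub_of_hasMajorant_exp (T₁ T₂ : SiteL2K ℂ d m c₁ W →ₗ[ℂ] SiteL2K ℂ d m c₁ W) {K δ : ℝ}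
    (hT : HasMajorant (g := toB6 (towerGeom L m n η M) Rr H) (fun q : TSite d m × ι => q.1) (conj b (readA φ T₁) - conj b (readA φ T₂))
      (fun a a' => K * Real.exp (-(δ * (towerGeom L m n η M).dist a a'))))
    (v : TSite d m) (g : SiteL2K ℂ d m c₁ W) (F : ℝ) (hF : 0 ≤ F) (hoff : ∀ x, x ≠ v → WL2.equiv ℂ (fun _ : TSite d m => c₁) W g x = 0)
    (hbd : ∀ x, x = v → ‖WL2.equiv ℂ (fun _ : TSite d m => c₁) W g x‖ ≤ F) (x : TSite d m) :
    ‖WL2.equiv ℂ (fun _ : TSite d m => c₁) W (T₁ g) x - WL2.equiv ℂ (fun _ : TSite d m => c₁) W (T₂ g) x‖ ≤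
      Mφ' * Mφ * ((∑ i, ‖b i‖) * M₂ * (K * Real.exp (-(δ * tdist1 m x v)))) * F := by
  rw [← conj_sub, ← readA_sub] at hT
  have h := siteRowW_of_hasMajorant_exp L m n η M Rr H φ hMφ hMφ' hφn hφn' b hM₂ hrepr (T₁ - T₂) hT v g F hF hoff hbd x
  rwa [LinearMap.sub_apply, WL2.equiv_sub, Pi.sub_apply] at h

/-- **(ii′) FOR A DIFFERENCE**: `conj b (readA φ T₁) − conj b (readA φ T₂) ≺ K·e^{−δ d₁}` (`K ≥ 0`, `δ > 0`) gives the lattice-free `ℓ^∞` letter of `T₁ − T₂`.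
[cite: Balaban1985BackgroundPropagators, (3.47) p.398, (3.67) p.403; Balaban1984PropagatorsII, (2.49) p.232, Lemma 2.1 (2.61) p.234] -/
theorem supRowW_sub_of_hasMajorant_exp (T₁ T₂ : SiteL2K ℂ d m c₁ W →ₗ[ℂ] SiteL2K ℂ d m c₁ W) {K δ : ℝ} (hK : 0 ≤ K) (hδ : 0 < δ)
    (hT : HasMajorant (g := toB6 (towerGeom L m n η M) Rr H) (fun q : TSite d m × ι => q.1) (conj b (readA φ T₁) - conj b (readA φ T₂))
      (fun a a' => K * Real.exp (-(δ * (towerGeom L m n η M).dist a a'))))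
    (g : SiteL2K ℂ d m c₁ W) (F : ℝ) (hF : 0 ≤ F) (hbd : ∀ x, ‖WL2.equiv ℂ (fun _ : TSite d m => c₁) W g x‖ ≤ F) (x : TSite d m) :
    ‖WL2.equiv ℂ (fun _ : TSite d m => c₁) W (T₁ g) x - WL2.equiv ℂ (fun _ : TSite d m => c₁) W (T₂ g) x‖ ≤
      Mφ' * Mφ * ((∑ i, ‖b i‖) * M₂ * (K * B6.c1 d δ 1)) * F := by
  rw [← conj_sub, ← readA_sub] at hT
  have h := supRowW_of_hasMajorant_exp L m n η M Rr H φ hMφ hMφ' hφn hφn' b hM₂ hrepr (T₁ - T₂) hK hδ hT g F hF hbd x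
  rwa [LinearMap.sub_apply, WL2.equiv_sub, Pi.sub_apply] at h

end Literature.MathematicalPhysics.QuantumFieldTheory.Balaban1983to89.B9Eq349TowerCoarseRowsOfMajorant

end
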